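import Literature.GroupTheory.CombinatorialGroupTheory.AmalgamConjugation
import HarnessLib

/-!
# The conjugation theorem for cyclically reduced words in an amalgam

Topic `Literature/GroupTheory/CombinatorialGroupTheory`; theorems only, continuing
`AmalgamReducedWords.lean` / `AmalgamConjugation.lean` (letter lists in Mathlib's
`Monoid.PushoutI φ`; reduced = alternating factors, no letter in the amalgamated subgroup; value
`ℓπ[φ] l`; an element is cyclically reduced when no reduced word of length `≥ 2` for it has both
ends in one factor).

* `exists_eq_base_mul_drop_mul_zpow` — **Magnus–Karrass–Solitar Thm. 4.6 (conjugacy of cyclically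
  reduced elements), in the form needed for centralizers**: let `w` be a reduced word of length
  `n ≥ 2` whose end letters lie in different factors and `W = ℓπ w`; if `h · W · h⁻¹` is cyclically
  reduced, then `h = (base c) · ℓπ (w.drop k) · W ^ q` for some `c ∈ H`, `k < n`, `q ∈ ℤ` — so
  that `h W h⁻¹` is `base c` times the `k`-th cyclic permutation of `w` times `(base c)⁻¹`.
  The proof is the classical induction on the length of a reduced word `hl` for `h`: its last
  letter must cancel into the base group against the last letter of `w` (from the right) or the
  first letter of `w` (from the left), by the three impossible configurations of
  `AmalgamConjugation.lean`; one then rotates `w` by one step and recurses.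

## References

* W. Magnus, A. Karrass, D. Solitar, *Combinatorial Group Theory*, Interscience (1966), §4.2,
  Thm. 4.6. [MagnusKarrassSolitar1966]
* R. C. Lyndon, P. E. Schupp, *Combinatorial Group Theory*, Springer (1977); Classics in
  Mathematics (2001), Ch. IV Thm. 2.8. [LyndonSchupp2001]
-/

namespace Literature.GroupTheory.CombinatorialGroupTheory

namespace Amalgam

open Monoid Monoid.PushoutI

variable {ι : Type*} {G : ι → Type*} [∀ i, Group (G i)] {H : Type*} [Group H]
  {φ : ∀ i, H →* G i}

/-- The value in `PushoutI φ` of a letter list. -/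
local notation3 "ℓπ[" φ "] " l:max =>
  List.prod (List.map (fun x => Monoid.PushoutI.of (φ := φ) (Sigma.fst x) (Sigma.snd x)) l)

/-! ### Small algebra -/

omit [∀ i, Group (G i)] in
/-- Alternation depends only on the sequence of factors. [cite: LyndonSchupp2001, Ch. IV §2] -/
theorem isChain_of_map_fst_eq {l l' : List (Σ i, G i)} (h : l.map Sigma.fst = l'.map Sigma.fst)
    (hl : l.IsChain fun a b => a.1 ≠ b.1) : l'.IsChain fun a b => a.1 ≠ b.1 := by
  have e : ∀ L : List (Σ i, G i), L.IsChain (fun a b => a.1 ≠ b.1) ↔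
      (L.map Sigma.fst).IsChain (fun i j => i ≠ j) := fun L => (List.isChain_map Sigma.fst).symm
  rw [e] at hl ⊢
  rwa [← h]

omit [∀ i, Group (G i)] in
/-- Changing the group component of the last letter keeps a word alternating.
[cite: LyndonSchupp2001, Ch. IV §2] -/
theorem isChain_concat_congr {P : List (Σ i, G i)} {j : ι} (x y : G j)
    (h : (P ++ [Sigma.mk j x]).IsChain fun a b => a.1 ≠ b.1) :
    (P ++ [Sigma.mk j y]).IsChain fun a b => a.1 ≠ b.1 :=
  isChain_of_map_fst_eq (by simp) h

/-! ### The conjugation theorem -/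

/-- **Conjugation theorem (MKS 4.6), centralizer form.**  Let `w` be a reduced word of length
`≥ 2` whose end letters lie in different factors, `W = ℓπ w`, and let `hl` be a reduced word
(of length `m`) with value `h`.  If `h W h⁻¹` is cyclically reduced — no reduced word of length
`≥ 2` for it has both end letters in one factor — then `h = (base c) · ℓπ (w.drop k) · W ^ q`
for some `c ∈ H`, `k < |w|`, `q ∈ ℤ`. [cite: MagnusKarrassSolitar1966, §4.2 Thm. 4.6] -/
theorem exists_eq_base_mul_drop_mul_zpow (m : ℕ) :
    ∀ (w hl : List (Σ i, G i)), 2 ≤ w.length →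
      w.IsChain (fun a b => a.1 ≠ b.1) → (∀ x ∈ w, x.2 ∉ (φ x.1).range) →
      (∀ x ∈ w.getLast?, ∀ y ∈ w.head?, x.1 ≠ y.1) →
      hl.length = m → hl.IsChain (fun a b => a.1 ≠ b.1) → (∀ x ∈ hl, x.2 ∉ (φ x.1).range) →
      (∀ L : List (Σ i, G i), L.IsChain (fun a b => a.1 ≠ b.1) →
        (∀ x ∈ L, x.2 ∉ (φ x.1).range) →
        ℓπ[φ] L = ℓπ[φ] hl * ℓπ[φ] w * (ℓπ[φ] hl)⁻¹ → 2 ≤ L.length →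
        L.head?.map Sigma.fst ≠ L.getLast?.map Sigma.fst) →
      ∃ (c : H) (k : ℕ) (q : ℤ), k < w.length ∧
        ℓπ[φ] hl = base φ c * ℓπ[φ] (w.drop k) * (ℓπ[φ] w) ^ q := by
  induction m with
  | zero =>
    intro w hl hn _ _ _ hlen _ _ _
    rw [List.length_eq_zero_iff] at hlen
    subst hlen
    exact ⟨1, 0, -1, by omega, by simp⟩
  | succ m ih =>
    intro w hl hn hwc hwr hcr hlen hhc hhr hY
    -- the last letter of `hl`
    have hne : hl ≠ [] := by rintro rfl; simp at hlen
    obtain ⟨hl', jx, rfl⟩ : ∃ P a, hl = P ++ [a] :=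
      ⟨hl.dropLast, hl.getLast hne, (List.dropLast_append_getLast hne).symm⟩
    obtain ⟨j, x⟩ := jx
    have hlen' : hl'.length = m := by simpa using hlen
    -- the end letters of `w`
    have hwne : w ≠ [] := by rintro rfl; simp at hn
    obtain ⟨γ₀, hw0⟩ : ∃ γ₀, w.head? = some γ₀ := ⟨_, List.head?_eq_some_head hwne⟩
    obtain ⟨γ, hw1⟩ : ∃ γ, w.getLast? = some γ := ⟨_, List.getLast?_eq_some_getLast hwne⟩
    have h01 : γ.1 ≠ γ₀.1 := hcr γ hw1 γ₀ hw0
    by_cases hB : j = γ.1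
    · -- the last letter of `h` lies in the factor of the last letter `γ` of `w`
      subst hB
      obtain ⟨w', hw⟩ : ∃ w', w = w' ++ [γ] := ⟨w.dropLast, (List.dropLast_append_getLast? γ hw1).symm⟩
      subst hw
      have hw'ne : w' ≠ [] := by rintro rfl; simp at hn
      have hw0' : w'.head? = some γ₀ := by rwa [List.head?_append_of_ne_nil _ hw'ne] at hw0
      by_cases hx : γ.2 * x⁻¹ ∈ (φ γ.1).range
      · obtain ⟨c, hc⟩ := hx
        have hxe : PushoutI.of (φ := φ) γ.1 x = base φ c⁻¹ * PushoutI.of γ.1 γ.2 := by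
          have : x = (φ γ.1 c)⁻¹ * γ.2 := by rw [hc]; group
          rw [this, map_mul, map_inv, of_apply_eq_base, map_inv]
        have hw'c : w'.IsChain (fun a b => a.1 ≠ b.1) := hwc.infix ⟨[], [γ], by simp⟩
        rcases List.eq_nil_or_concat hl' with h0 | ⟨hl'', ⟨j', x'⟩, h0⟩
        · -- `h = x`
          subst h0
          refine ⟨c⁻¹, w'.length, 0, by simp, ?_⟩
          rw [List.nil_append, lprod_singleton, List.drop_left, lprod_singleton, zpow_zero, mul_one]
          exact hxe
        · rw [List.concat_eq_append] at h0
          subst h0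
          -- rotate: `hl₂ = hl'' (x' φc⁻¹)`, `w₂ = γ w'`
          have hx' : x' ∉ (φ j').range :=
            hhr ⟨j', x'⟩ (List.mem_append_left _ (List.mem_append_right _ (List.mem_singleton_self _)))
          have hlen₂ : (hl'' ++ [Sigma.mk j' (x' * φ j' c⁻¹)]).length = m := by
            simpa using hlen'
          have hhc₂ : (hl'' ++ [Sigma.mk j' (x' * φ j' c⁻¹)]).IsChain (fun a b => a.1 ≠ b.1) :=
            isChain_concat_congr x' _ (hhc.infix ⟨[], [⟨γ.1, x⟩], by simp⟩)
          have hhr₂ : ∀ y ∈ hl'' ++ [Sigma.mk j' (x' * φ j' c⁻¹)], y.2 ∉ (φ y.1).range := by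
            intro y hy
            rw [List.mem_append, List.mem_singleton] at hy
            rcases hy with hy | rfl
            · exact hhr y (by simp [hy])
            · simpa using mul_not_mem_range hx' 1 c⁻¹
          have hE₂ : ℓπ[φ] (hl'' ++ [Sigma.mk j' (x' * φ j' c⁻¹)]) =
              ℓπ[φ] (hl'' ++ [⟨j', x'⟩]) * base φ c⁻¹ := (lprod_concat_mul_base c⁻¹ j' x' hl'').symm
          have hE : ℓπ[φ] (hl'' ++ [⟨j', x'⟩] ++ [⟨γ.1, x⟩]) =
              ℓπ[φ] (hl'' ++ [Sigma.mk j' (x' * φ j' c⁻¹)]) * PushoutI.of γ.1 γ.2 := by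
            rw [lprod_append _ [_], lprod_singleton, hE₂, mul_assoc, ← hxe]
          have hw₂c : (γ :: w').IsChain (fun a b => a.1 ≠ b.1) :=
            isChain_cons_of_head hw'c fun b hb => by rw [hw0'] at hb; cases hb; exact h01
          have hw₂r : ∀ y ∈ γ :: w', y.2 ∉ (φ y.1).range := fun y hy => by
            rw [List.mem_cons] at hy
            rcases hy with rfl | hy
            · exact hwr _ (by simp)
            · exact hwr _ (List.mem_append_left _ hy)
          have hw₂cr : ∀ a ∈ (γ :: w').getLast?, ∀ b ∈ (γ :: w').head?, a.1 ≠ b.1 := by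
            intro a ha b hb
            rw [List.head?_cons, Option.mem_some_iff] at hb
            subst hb
            rw [List.getLast?_cons, List.getLast?_eq_some_getLast hw'ne, Option.getD_some,
              Option.mem_some_iff] at ha
            subst ha
            exact rel_of_isChain_concat hwc _ (List.getLast?_eq_some_getLast hw'ne)
          have hY₂ : ∀ L : List (Σ i, G i), L.IsChain (fun a b => a.1 ≠ b.1) →
              (∀ x ∈ L, x.2 ∉ (φ x.1).range) →
              ℓπ[φ] L = ℓπ[φ] (hl'' ++ [Sigma.mk j' (x' * φ j' c⁻¹)]) * ℓπ[φ] (γ :: w') *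
                (ℓπ[φ] (hl'' ++ [Sigma.mk j' (x' * φ j' c⁻¹)]))⁻¹ → 2 ≤ L.length →
              L.head?.map Sigma.fst ≠ L.getLast?.map Sigma.fst := by
            intro L hLc hLr hval h2
            refine hY L hLc hLr ?_ h2
            rw [hval, hE, lprod_cons, lprod_append w' [γ], lprod_singleton]
            group
          obtain ⟨c', k, q, hk, hEq⟩ := ih (γ :: w') _
            (by simp only [List.length_cons, List.length_append] at hn ⊢; omega)
            hw₂c hw₂r hw₂cr hlen₂ hhc₂ hhr₂ hY₂
          -- express everything through `A = γ` and `W = ℓπ (w' γ)`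
          have hW₂ : ℓπ[φ] (γ :: w') =
              PushoutI.of γ.1 γ.2 * ℓπ[φ] (w' ++ [γ]) * (PushoutI.of γ.1 γ.2)⁻¹ := by
            rw [lprod_cons, lprod_append, lprod_singleton]; group
          cases k with
          | zero =>
            refine ⟨c', w'.length, q + 1, by simp, ?_⟩
            rw [List.drop_zero, hW₂, conj_zpow] at hEq
            rw [hE, hEq, List.drop_left, lprod_singleton]
            group
          | succ k =>
            have hk' : k ≤ w'.length := by
              simp only [List.length_cons] at hk; omega
            refine ⟨c', k, q, by simp only [List.length_append, List.length_singleton]; omega, ?_⟩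
            rw [List.drop_succ_cons, hW₂, conj_zpow] at hEq
            rw [hE, hEq, List.drop_append_of_le_length hk', lprod_append (List.drop k w') [γ],
              lprod_singleton]
            group
      · exact absurd hY (not_cr_conj_of_last hhc hhr hwc hwr hw0' h01 hx)
    · by_cases hC : j = γ₀.1
      · -- the last letter of `h` lies in the factor of the first letter `γ₀` of `w`
        subst hC
        obtain ⟨w', hw⟩ : ∃ w', w = γ₀ :: w' := ⟨w.tail, List.eq_cons_of_mem_head? hw0⟩
        subst hw
        have hw'ne : w' ≠ [] := by rintro rfl; simp at hn
        have hw1' : w'.getLast? = some γ := by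
          rw [List.getLast?_cons, List.getLast?_eq_some_getLast hw'ne, Option.getD_some] at hw1
          rw [List.getLast?_eq_some_getLast hw'ne, hw1]
        by_cases hx : x * γ₀.2 ∈ (φ γ₀.1).range
        · obtain ⟨c, hc⟩ := hx
          have hxe : PushoutI.of (φ := φ) γ₀.1 x = base φ c * (PushoutI.of γ₀.1 γ₀.2)⁻¹ := by
            have : x = φ γ₀.1 c * γ₀.2⁻¹ := by rw [hc]; group
            rw [this, map_mul, map_inv, of_apply_eq_base]
          rcases List.eq_nil_or_concat hl' with h0 | ⟨hl'', ⟨j', x'⟩, h0⟩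
          · subst h0
            refine ⟨c, 1, -1, by have := List.length_pos_of_ne_nil hw'ne; simp only [List.length_cons]; omega, ?_⟩
            rw [List.nil_append, lprod_singleton, List.drop_succ_cons, List.drop_zero, lprod_cons, hxe]
            group
          · rw [List.concat_eq_append] at h0
            subst h0
            have hx' : x' ∉ (φ j').range :=
            hhr ⟨j', x'⟩ (List.mem_append_left _ (List.mem_append_right _ (List.mem_singleton_self _)))
            have hlen₂ : (hl'' ++ [Sigma.mk j' (x' * φ j' c)]).length = m := by simpa using hlen'
            have hhc₂ : (hl'' ++ [Sigma.mk j' (x' * φ j' c)]).IsChain (fun a b => a.1 ≠ b.1) :=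
              isChain_concat_congr x' _ (hhc.infix ⟨[], [⟨γ₀.1, x⟩], by simp⟩)
            have hhr₂ : ∀ y ∈ hl'' ++ [Sigma.mk j' (x' * φ j' c)], y.2 ∉ (φ y.1).range := by
              intro y hy
              rw [List.mem_append, List.mem_singleton] at hy
              rcases hy with hy | rfl
              · exact hhr y (by simp [hy])
              · simpa using mul_not_mem_range hx' 1 c
            have hE₂ : ℓπ[φ] (hl'' ++ [Sigma.mk j' (x' * φ j' c)]) =
                ℓπ[φ] (hl'' ++ [⟨j', x'⟩]) * base φ c := (lprod_concat_mul_base c j' x' hl'').symm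
            have hE : ℓπ[φ] (hl'' ++ [⟨j', x'⟩] ++ [⟨γ₀.1, x⟩]) =
                ℓπ[φ] (hl'' ++ [Sigma.mk j' (x' * φ j' c)]) * (PushoutI.of γ₀.1 γ₀.2)⁻¹ := by
              rw [lprod_append _ [_], lprod_singleton, hE₂, mul_assoc, ← hxe]
            have hw₂c : (w' ++ [γ₀]).IsChain (fun a b => a.1 ≠ b.1) :=
              isChain_append_cons hwc.tail (List.IsChain.singleton _) fun b hb => by
                rw [hw1'] at hb; cases hb; exact h01
            have hw₂r : ∀ y ∈ w' ++ [γ₀], y.2 ∉ (φ y.1).range := fun y hy => by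
              rw [List.mem_append, List.mem_singleton] at hy
              rcases hy with hy | rfl
              · exact hwr _ (List.mem_cons_of_mem _ hy)
              · exact hwr _ List.mem_cons_self
            have hw₂cr : ∀ a ∈ (w' ++ [γ₀]).getLast?, ∀ b ∈ (w' ++ [γ₀]).head?, a.1 ≠ b.1 := by
              intro a ha b hb
              rw [List.getLast?_concat, Option.mem_some_iff] at ha
              subst ha
              rw [List.head?_append_of_ne_nil _ hw'ne] at hb
              exact hwc.rel_head? hb
            have hY₂ : ∀ L : List (Σ i, G i), L.IsChain (fun a b => a.1 ≠ b.1) →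
                (∀ x ∈ L, x.2 ∉ (φ x.1).range) →
                ℓπ[φ] L = ℓπ[φ] (hl'' ++ [Sigma.mk j' (x' * φ j' c)]) * ℓπ[φ] (w' ++ [γ₀]) *
                  (ℓπ[φ] (hl'' ++ [Sigma.mk j' (x' * φ j' c)]))⁻¹ → 2 ≤ L.length →
                L.head?.map Sigma.fst ≠ L.getLast?.map Sigma.fst := by
              intro L hLc hLr hval h2
              refine hY L hLc hLr ?_ h2
              rw [hval, hE, lprod_cons, lprod_append w' [γ₀], lprod_singleton]
              group
            obtain ⟨c', k, q, hk, hEq⟩ := ih (w' ++ [γ₀]) _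
              (by simp only [List.length_cons, List.length_append] at hn ⊢; omega)
              hw₂c hw₂r hw₂cr hlen₂ hhc₂ hhr₂ hY₂
            -- express everything through `A = γ₀` and `W = ℓπ (γ₀ w')`
            have hW₂ : ℓπ[φ] (w' ++ [γ₀]) =
                (PushoutI.of γ₀.1 γ₀.2)⁻¹ * ℓπ[φ] (γ₀ :: w') * (PushoutI.of γ₀.1 γ₀.2)⁻¹⁻¹ := by
              rw [lprod_cons, lprod_append, lprod_singleton]; group
            have hk' : k ≤ w'.length := by
              simp only [List.length_append, List.length_singleton] at hk; omega
            rcases hk'.lt_or_eq with hk' | hk'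
            · refine ⟨c', k + 1, q, by simp only [List.length_cons]; omega, ?_⟩
              rw [List.drop_append_of_le_length hk'.le, lprod_append (List.drop k w') [γ₀],
                lprod_singleton, hW₂, conj_zpow] at hEq
              rw [hE, hEq, List.drop_succ_cons]
              group
            · refine ⟨c', 0, q - 1, by simp, ?_⟩
              rw [hk', List.drop_left, lprod_singleton, hW₂, conj_zpow] at hEq
              rw [hE, hEq, List.drop_zero]
              group
        · exact absurd hY (not_cr_conj_of_head hhc hhr hwc hwr hw1' h01 hx)
      · exact absurd hY (not_cr_conj_of_ne_ne hhc hhr hwc hwr hw0 hw1 hC hB)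

end Amalgam

end Literature.GroupTheory.CombinatorialGroupTheory
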